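import Literature.AnabelianGeometry.SemiGraphs.SgATemperedArrowsLocallyFiniteEtale
import Literature.AnabelianGeometry.SemiGraphs.AmbientVocabOfRealOut
import Literature.AnabelianGeometry.SemiGraphs.InterfaceVocabBrLaws
import HarnessLib

/-!
# `SemiAnbdVocab.real`: the [SemiAnbd] §§4–5 container at the real vocabulary with NO parameter (merge step M8)

Mochizuki, *Semi-graphs of anabelioids*, Publ. RIMS **42** (2006), Rmk 2.4.2 p. 26 (the ambient
category), Def 3.5 (ii) p. 37 ("`B(𝒢) ↪ B^temp(𝒢) ↪ B^cov(𝒢)`"; tempered coverings), Rmk 3.5.2 p. 38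
(tempered ⇒ locally finite étale) (kurims `paper:url-f33ace170ff4`). [cite: MochizukiSemiAnbd2006, Rmk 2.4.2, p. 26]

THE LAST MERGE STEP of the abc-iut-L3-t3 lineage (HOME/staging/L3/L3-t3/MERGE-MAP.md): gen 4's
`SemiAnbdVocab.ofRealOfTempered (T : SgA.TemperedResidual)` had every one of the ≈ 70 container
fields REAL except the class of tempered arrows `T` with its two laws.  Over the gen-5 bridge
(B1 `SgAToProfinite`, B2 `SgAToProfiniteHom`, B3 `SgAToProfiniteCompare`, B4
`SgATemperedArrows` — `SgA.IsTemperedCoveringOf`, Def 3.5 (ii) through abc-iut-L3-t2/d6's `B^cov` —,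
B5 `SgAToProfiniteFiniteEtale`, L2 `SgATemperedArrowsLocallyFiniteEtale`) this file instantiates it:

* `SgA.IsTemperedArrow f := finiteEtale f ∨ IsTemperedCoveringOf f` — print's "`B(𝒢) ↪ B^temp(𝒢)`"
  together with the honest tempered coverings; the first disjunct is redundant wherever print
  DEFINES tempered coverings (connected, countable: `FiniteIsTempered_holds`; arrow-level law L1
  owed, R1-BRIDGE-SHAPES.md §2) and is what the container's ALL-objects law "finite étale ⇒ tempered"
  requires where print leaves the term undefined;
* `SgA.TemperedResidual.real` — both laws PROVED (`isTemperedArrow_of_finiteEtale`, trivially;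
  `locallyFiniteEtale_of_isTemperedArrow`, by law L2); `SgA.BridgeResidual.real`;
* **`SemiAnbdVocab.real : SemiAnbdVocab SgA`** — conditional on NOTHING; `real_eq_ofReal` (rfl, so the
  whole `ofReal_*` dictionary applies), `real_isTempered_iff`, `real_brLaws`.

Honest scope: one universe (`SgA.{u,u,u}`, as `ofRealOfTempered`); `OutVert` is junk outside the
topologically-finitely-generated case (gen 4 convention); L1 owed.  Nothing of the paper is asserted;
no side taken on [IUTchIII] Cor. 3.12; typed ≠ proved for the §§4–5 STATEMENTS themselves.
-/

noncomputable section

namespace Literature.AnabelianGeometry.SemiGraphs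

open CategoryTheory

universe u

namespace SgAQuot.SgA

variable {G H : SgA.{u, u, u}}

/-- **Tempered arrows of the ambient category `SgA`** ([SemiAnbd] Def 3.5 (ii) p.37 read on arrows,
for the law-shape of the §§4–5 container): `f : G → H` is tempered if it is a FINITE ÉTALE covering
(print's displayed full embedding "`B(𝒢) ↪ B^temp(𝒢)`") or is realised, over the profinite
presentation of `H`, by a TEMPERED object of `B^cov(H.toProfinite)` (`IsTemperedCoveringOf`, the
honest Def 3.5 (ii)).  For the targets where print DEFINES tempered coverings (each connected
component countable, §3 p.36; Def 5.1 (iv): "a term which … only makes sense when `𝔾` is countable")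
the first disjunct is implied by the second (finite objects of `B^cov` are tempered,
`ProfiniteSemiGraph.FiniteIsTempered_holds`; the arrow-level form is law L1 of
HOME/staging/L3/L3-t3/R1-BRIDGE-SHAPES.md §2, still owed); it is kept so that the container law
"finite étale ⇒ tempered", which `SemiAnbdVocab` states for ALL objects, holds verbatim also where
print leaves "tempered" undefined. [cite: MochizukiSemiAnbd2006, Def 3.5(ii) p.37] -/
def IsTemperedArrow (f : G ⟶ H) : Prop := finiteEtale f.hom.hom ∨ IsTemperedCoveringOf f

/-- Finite étale coverings are tempered arrows ("`B(𝒢) ↪ B^temp(𝒢)`").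
[cite: MochizukiSemiAnbd2006, Def 3.5(ii) p.37] -/
theorem isTemperedArrow_of_finiteEtale (f : G ⟶ H) (h : finiteEtale f.hom.hom) : IsTemperedArrow f :=
  Or.inl h

/-- Arrows realised by a tempered object of `B^cov(H.toProfinite)` are tempered arrows.
[cite: MochizukiSemiAnbd2006, Def 3.5(ii) p.37] -/
theorem isTemperedArrow_of_isTemperedCoveringOf (f : G ⟶ H) (h : IsTemperedCoveringOf f) :
    IsTemperedArrow f :=
  Or.inr h

/-- **Tempered arrows are locally finite étale** (Def 3.5 (ii) with Rmk 3.5.2 p.38): the finite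
étale ones by Def 2.2 (i) (`locallyFiniteEtale_of_finiteEtale`), the others by law L2
(`locallyFiniteEtale_of_isTemperedCoveringOf`: their constituents are open stabiliser inclusions).
[cite: MochizukiSemiAnbd2006, Rmk 3.5.2, p. 38] -/
theorem locallyFiniteEtale_of_isTemperedArrow (f : G ⟶ H) (h : IsTemperedArrow f) :
    locallyFiniteEtale f.hom.hom :=
  h.elim locallyFiniteEtale_of_finiteEtale (locallyFiniteEtale_of_isTemperedCoveringOf f)

/-- **The reduced residual of the L3 bridge, INSTANTIATED** (no parameter left): tempered arrows :=
`IsTemperedArrow`, with both laws of `SgA.TemperedResidual` PROVED.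
[cite: MochizukiSemiAnbd2006, Def 3.5(ii) p.37] -/
def TemperedResidual.real : TemperedResidual.{u} where
  IsTempered f := IsTemperedArrow f
  isTempered_of_finiteEtale f h := isTemperedArrow_of_finiteEtale f h
  locallyFiniteEtale_of_isTempered f h := locallyFiniteEtale_of_isTemperedArrow f h

/-- The full bridge residual, instantiated (`OutVert`/`outRep` from `BridgeResidual.ofTempered`,
abc-iut-L3-t3 gen 4). [cite: MochizukiSemiAnbd2006, Def 5.1 (i), p. 62] -/
def BridgeResidual.real : BridgeResidual.{u, u, u} := BridgeResidual.ofTempered TemperedResidual.real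

/-- The tempered arrows of the instantiated residual are `IsTemperedArrow` (by `rfl`).
[cite: MochizukiSemiAnbd2006, Def 3.5(ii) p.37] -/
theorem TemperedResidual.real_isTempered_iff (f : G ⟶ H) :
    TemperedResidual.real.IsTempered f ↔ IsTemperedArrow f :=
  Iff.rfl

end SgAQuot.SgA

/-- **`SemiAnbdVocab.real` — THE §§4–5 CONTAINER OF [SemiAnbd] AT THE REAL VOCABULARY WITH NO
PARAMETER** (one universe): `SemiAnbdVocab.ofRealOfTempered` (abc-iut-L3-t3 gen 4: every field real
but the tempered arrows) at `SgA.TemperedResidual.real` (gen 5: tempered arrows through the t1 → t2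
presentation bridge B1–B5 and law L2).  Every declaration of `Localizations*.lean` /
`Arithmetic*.lean` parametrised by `(𝓥 : SemiAnbdVocab Obj)` specialises at this term to a statement
about the tree's totally aloof, verticially slim semi-graphs of anabelioids, their locally open
morphisms, finite étale / tempered coverings and profinite `Out(π̂₁(𝒢_v))` — conditionally on
NOTHING. [cite: MochizukiSemiAnbd2006, Rmk 2.4.2, p. 26] -/
noncomputable def SemiAnbdVocab.real : SemiAnbdVocab SgAQuot.SgA.{u, u, u} :=
  SemiAnbdVocab.ofRealOfTempered SgAQuot.SgA.TemperedResidual.real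

/-- `SemiAnbdVocab.real` is `ofReal` at the instantiated bridge residual (by `rfl`), so every
dictionary lemma `SemiAnbdVocab.ofReal_*` / `LocalAdjectives.ofReal_*` of the lineage applies to it.
[cite: MochizukiSemiAnbd2006, Rmk 2.4.2, p. 26] -/
theorem SemiAnbdVocab.real_eq_ofReal :
    SemiAnbdVocab.real = SemiAnbdVocab.ofReal SgAQuot.SgA.BridgeResidual.real := rfl

/-- The tempered arrows of `SemiAnbdVocab.real` are the tempered arrows of `SgA` (by `rfl`).
[cite: MochizukiSemiAnbd2006, Def 3.5(ii) p.37] -/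
theorem SemiAnbdVocab.real_isTempered_iff {G H : SgAQuot.SgA.{u, u, u}} (f : G ⟶ H) :
    SemiAnbdVocab.real.IsTempered f ↔ SgAQuot.SgA.IsTemperedArrow f :=
  Iff.rfl

/-- The branch-map laws hold at `SemiAnbdVocab.real` (gen 5 `SemiAnbdVocab.BrLaws`, GAP G-f184-1).
[cite: MochizukiSemiAnbd2006, §1, p. 11] -/
theorem SemiAnbdVocab.real_brLaws : SemiAnbdVocab.real.{u}.BrLaws :=
  SemiAnbdVocab.ofReal_brLaws _

end Literature.AnabelianGeometry.SemiGraphs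

end
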